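import Summits.AtomisticToContinuum.HydrodynamicLimit.Theses.JaynesSqueeze
import Summits.AtomisticToContinuum.HydrodynamicLimit.Theorems.DenseExcursion.Negative.Everywhere
import Literature.MathematicalPhysics.KineticTheory.HardSphereEulerProofs
import Literature.Analysis.FunctionSpaces.TorusSpaceTime

/-!
# `BlockGibbsToRelEntropy` (stmt-AtomisticToContinuum-13464), I: reduction to the relative-entropy estimate at the Euler-driven reference

Route JaynesSqueeze, support item `BlockGibbsToRelEntropy` (the closure
`BlockGibbs → CollisionalFluxLocality → EnergyCurrentTails → MeanBlocksInRange → EntropicWeakStrongHS →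
HardSphereLDA → LocalGibbsConcentrationDilute → HsEosLowDensity → DiluteSelfConsistency →
RelEntropyVanishing`). The consequent `RelEntropyVanishing` (shared typed target
stmt-AtomisticToContinuum-0766) has four clauses; three of them are STATICS of the Euler-driven reference
and are discharged here, so that the item is reduced to Yau's relative-entropy estimate proper:

* the initial local Gibbs laws are probability measures — `isProbabilityMeasure_localGibbsLaw` at
  `σ ≤ 1/2`;
* at every `t ∈ [0, T)` the EULER-DRIVEN REFERENCE, i.e. the local Gibbs law with the explicit activity
  `a_t = ρ_t · exp (g_σ(ρ_t))`, `g_σ(r) = f_ex(rσ³) + rσ³ f_ex'(rσ³)` (the `let g` of `HardSphereLDA` /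
  `LocalGibbsConcentrationDilute`), velocity `u_t` and temperature `θ_t`, is a probability measure
  (`HardSphereLDA` (B)) whose empirical density / momentum / energy fields concentrate exponentially
  around `(ρ, ρu, E)(t)` (`LocalGibbsConcentrationDilute`). Their side conditions are produced from the
  classical solution: `ρ_t, u_t, θ_t` continuous (time slices of jointly smooth fields), `ρ_t ≥ min ρ_t > 0`
  (compact torus), packing `ρ_t σ³ ≤ η₁` (`DiluteSelfConsistency` at `η = min η₁ η₂`, the two thresholds of
  the two statics), and unit mass `∫ ρ_t = 1` (mass conservation `integral_density_eq` + unit admissible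
  mass `integral_density_zero_eq_one`, Theorems/DenseExcursion/Negative/Everywhere);
* what remains is the fourth clause ALONE, with the reference now explicit:
  `KL(lawAt Φ_N λ_N t ‖ localGibbsLaw σ a_t u_t θ_t)/(N+1) → 0` — `relEntropyVanishing_of_klCore`
  takes it as the hypothesis `core` (next to the four statics items it consumes), and
  `blockGibbsToRelEntropy_of_klCore` is the item modulo that core stated under all nine antecedents.

No definitions are introduced (the core statement is written out). prover-pitem-stmt-AtomisticToContinuum-13464-0.
-/

noncomputable section

namespace Summit.AtomisticToContinuum.HydrodynamicLimit.Theorems.JaynesSqueezeClosure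

open MeasureTheory Filter Set Topology InformationTheory
open scoped ENNReal
open Literature.MathematicalPhysics.KineticTheory Literature.Analysis.FluidPDE Literature.Analysis.FunctionSpaces
open Summit.AtomisticToContinuum.HydrodynamicLimit.Theses.JaynesSqueeze

/-- **The statics of the Euler-driven reference.** Given `HardSphereLDA`, `LocalGibbsConcentrationDilute` (both
fed `HsEosLowDensity`) with thresholds `η₁, η₂`, a classical hard-sphere-Euler solution `(ρ, u, θ)` on `[0, T)`
at `σ ≤ 1/2` tied at `t = 0` to the local Gibbs laws of continuous positive profiles through the flow family
`Φ`, and a time `t ∈ [0, T)` at which the packing satisfies `ρ_t σ³ < min η₁ η₂`: the local Gibbs law with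
activity `a_t = ρ_t e^{g_σ(ρ_t)}`, velocity `u_t` and temperature `θ_t` is a probability measure and its three
empirical fields concentrate exponentially around `(ρ, ρu, E)(t)` (unit mass of `ρ_t` by mass conservation and
the `χ ≡ 1` test of the tie). [folklore] -/
theorem reference_statics {η₁ η₂ σ : ℝ} (hσ2 : σ ≤ 1 / 2)
    (HL : ∀ c : ℝ, 0 < c → ∀ ρ₁ : T3 → ℝ, Measurable ρ₁ → (∀ x, c ≤ ρ₁ x ∧ ρ₁ x * σ ^ 3 ≤ η₁) →
      ∫ x, ρ₁ x = 1 → ∀ (u₁ : T3 → V3) (θ₁ : T3 → ℝ), Measurable u₁ → Measurable θ₁ → (∀ x, 0 < θ₁ x) →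
      ∀ Φ : (N : ℕ) → HardSphereFlow (Torus.geometry (Fin 3)) (hsDiameter σ N) (N + 1),
      let a₁ : T3 → ℝ := fun x => ρ₁ x * Real.exp (hsExcessFreeEnergy (ρ₁ x * σ ^ 3) +
        ρ₁ x * σ ^ 3 * deriv hsExcessFreeEnergy (ρ₁ x * σ ^ 3))
      Tendsto (fun N : ℕ => ((N : ℝ) + 1)⁻¹ * Real.log (canonicalPartition (Torus.geometry (Fin 3))
        (hsDiameter σ N) (N + 1) (localGibbsProfile a₁ u₁ θ₁))) atTop
        (𝓝 (∫ x, ρ₁ x * (ρ₁ x * σ ^ 3 * deriv hsExcessFreeEnergy (ρ₁ x * σ ^ 3)))) ∧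
      (∀ N, IsProbabilityMeasure (localGibbsLaw σ a₁ u₁ θ₁ N (Φ N))) ∧
      ∀ χ : T3 → ℝ, Continuous χ → Tendsto (fun N : ℕ => ∫ z, empiricalDensityField z χ
        ∂(localGibbsLaw σ a₁ u₁ θ₁ N (Φ N))) atTop (𝓝 (∫ x, χ x * ρ₁ x)))
    (HC : ∀ c : ℝ, 0 < c → ∀ ρ₁ : T3 → ℝ, Continuous ρ₁ → (∀ x, c ≤ ρ₁ x ∧ ρ₁ x * σ ^ 3 ≤ η₂) →
      ∫ x, ρ₁ x = 1 → ∀ (u₁ : T3 → V3) (θ₁ : T3 → ℝ), Continuous u₁ → Continuous θ₁ → (∀ x, 0 < θ₁ x) →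
      let a₁ : T3 → ℝ := fun x => ρ₁ x * Real.exp (hsExcessFreeEnergy (ρ₁ x * σ ^ 3) +
        ρ₁ x * σ ^ 3 * deriv hsExcessFreeEnergy (ρ₁ x * σ ^ 3))
      ∀ χ : T3 → ℝ, Continuous χ → ∀ δ : ℝ, 0 < δ → ∃ C : ℝ, 0 < C ∧
        ∀ (N : ℕ) (Φ : HardSphereFlow (Torus.geometry (Fin 3)) (hsDiameter σ N) (N + 1)),
        localGibbsLaw σ a₁ u₁ θ₁ N Φ {z | δ < |empiricalDensityField z χ - ∫ x, χ x * ρ₁ x|} ≤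
            ENNReal.ofReal (C * Real.exp (-(C⁻¹ * (N + 1)))) ∧
          localGibbsLaw σ a₁ u₁ θ₁ N Φ {z | δ < ‖empiricalMomentumField z χ - ∫ x, (χ x * ρ₁ x) • u₁ x‖} ≤
            ENNReal.ofReal (C * Real.exp (-(C⁻¹ * (N + 1)))) ∧
          localGibbsLaw σ a₁ u₁ θ₁ N Φ {z | δ < |empiricalEnergyField z χ -
              ∫ x, χ x * totalEnergyDensity (ρ₁ x) (u₁ x) (θ₁ x)|} ≤
            ENNReal.ofReal (C * Real.exp (-(C⁻¹ * (N + 1)))))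
    {a₀ θ₀ : T3 → ℝ} {u₀ : T3 → V3} (ha : Continuous a₀) (hθ : Continuous θ₀) (hu : Continuous u₀)
    (ha0 : ∀ x, 0 < a₀ x) (hθ0 : ∀ x, 0 < θ₀ x)
    {T : ℝ} {ρ θ : ℝ → T3 → ℝ} {u : ℝ → T3 → V3} (hE : IsHardSphereEulerSolution σ T ρ u θ)
    (Φ : (N : ℕ) → HardSphereFlow (Torus.geometry (Fin 3)) (hsDiameter σ N) (N + 1))
    (htie : TendstoHydroFieldsAt (fun N => localGibbsLaw σ a₀ u₀ θ₀ N (Φ N)) Φ ρ u θ 0)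
    {t : ℝ} (ht : t ∈ Ico 0 T) (hpack : ∀ x, ρ t x * σ ^ 3 < min η₁ η₂) :
    (∀ N, IsProbabilityMeasure (localGibbsLaw σ (fun x => ρ t x * Real.exp (hsExcessFreeEnergy (ρ t x * σ ^ 3) +
        ρ t x * σ ^ 3 * deriv hsExcessFreeEnergy (ρ t x * σ ^ 3))) (u t) (θ t) N (Φ N))) ∧
    ∀ χ : T3 → ℝ, Continuous χ → ∀ δ : ℝ, 0 < δ → ∃ C : ℝ, 0 < C ∧ ∀ N : ℕ,
      localGibbsLaw σ (fun x => ρ t x * Real.exp (hsExcessFreeEnergy (ρ t x * σ ^ 3) +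
          ρ t x * σ ^ 3 * deriv hsExcessFreeEnergy (ρ t x * σ ^ 3))) (u t) (θ t) N (Φ N)
          {z | δ < |empiricalDensityField z χ - ∫ x, χ x * ρ t x|} ≤
        ENNReal.ofReal (C * Real.exp (-(C⁻¹ * (N + 1)))) ∧
      localGibbsLaw σ (fun x => ρ t x * Real.exp (hsExcessFreeEnergy (ρ t x * σ ^ 3) +
          ρ t x * σ ^ 3 * deriv hsExcessFreeEnergy (ρ t x * σ ^ 3))) (u t) (θ t) N (Φ N)
          {z | δ < ‖empiricalMomentumField z χ - ∫ x, (χ x * ρ t x) • u t x‖} ≤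
        ENNReal.ofReal (C * Real.exp (-(C⁻¹ * (N + 1)))) ∧
      localGibbsLaw σ (fun x => ρ t x * Real.exp (hsExcessFreeEnergy (ρ t x * σ ^ 3) +
          ρ t x * σ ^ 3 * deriv hsExcessFreeEnergy (ρ t x * σ ^ 3))) (u t) (θ t) N (Φ N)
          {z | δ < |empiricalEnergyField z χ - ∫ x, χ x * totalEnergyDensity (ρ t x) (u t x) (θ t x)|} ≤
        ENNReal.ofReal (C * Real.exp (-(C⁻¹ * (N + 1)))) := by
  -- the Euler fields at time `t`
  have hρc : Continuous (ρ t) := (hE.smooth_density.isSmooth_slice ht).continuous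
  have huc : Continuous (u t) := (hE.smooth_velocity.isSmooth_slice ht).continuous
  have hθc : Continuous (θ t) := (hE.smooth_temperature.isSmooth_slice ht).continuous
  have hθpos : ∀ x, 0 < θ t x := hE.temperature_pos t ht
  have hρpos : ∀ x, 0 < ρ t x := hE.density_pos t ht
  -- a positive lower bound of `ρ t` (compact torus)
  obtain ⟨x₀, -, hx₀⟩ := isCompact_univ.exists_isMinOn univ_nonempty hρc.continuousOn
  have hmin : ∀ x, ρ t x₀ ≤ ρ t x := fun x => (isMinOn_iff.mp hx₀) x (mem_univ x)
  -- unit mass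
  have hmass : ∫ x, ρ t x = 1 := by
    rw [DenseExcursionEverywhere.integral_density_eq hE ht]
    exact DenseExcursionEverywhere.integral_density_zero_eq_one hσ2 ha hθ hu ha0 hθ0 Φ htie
  refine ⟨?_, fun χ hχ δ hδ => ?_⟩
  · have HB := HL (ρ t x₀) (hρpos x₀) (ρ t) hρc.measurable
      (fun x => ⟨hmin x, (hpack x).le.trans (min_le_left _ _)⟩) hmass (u t) (θ t) huc.measurable
      hθc.measurable hθpos Φ
    exact HB.2.1
  · obtain ⟨C, hC, hN⟩ := HC (ρ t x₀) (hρpos x₀) (ρ t) hρc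
      (fun x => ⟨hmin x, (hpack x).le.trans (min_le_right _ _)⟩) hmass (u t) (θ t) huc hθc hθpos χ hχ δ hδ
    exact ⟨C, hC, fun N => hN N (Φ N)⟩

/-- **`RelEntropyVanishing` from its relative-entropy core at the Euler-driven reference.** If, for continuous
positive profiles, below some `σ₀`, along every classical hard-sphere-Euler solution tied at `t = 0` to the
local Gibbs laws through a flow family, the specific relative entropy of the law at time `t ∈ [0, T)` with
respect to the local Gibbs law of the EXPLICIT reference `(ρ_t e^{g_σ(ρ_t)}, u_t, θ_t)` vanishes
(`core` — Yau's estimate, the analytic content of item `BlockGibbsToRelEntropy`), then the four statics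
`HardSphereLDA`, `LocalGibbsConcentrationDilute`, `HsEosLowDensity`, `DiluteSelfConsistency` give the shared target
`RelEntropyVanishing` (stmt-AtomisticToContinuum-0766), with `σ₀ := min (1/2) (min σ₀^core σ₀^D)`, `σ₀^D` the
threshold of `DiluteSelfConsistency` at `η = min η₁ η₂`. [cite: Yau1991, §2] -/
theorem relEntropyVanishing_of_klCore
    (core : ∀ (a₀ θ₀ : T3 → ℝ) (u₀ : T3 → V3), Continuous a₀ → Continuous θ₀ → Continuous u₀ →
      (∀ x, 0 < a₀ x) → (∀ x, 0 < θ₀ x) → ∃ σ₀ : ℝ, 0 < σ₀ ∧ ∀ σ : ℝ, 0 < σ → σ < σ₀ →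
      ∀ (T : ℝ) (ρ θ : ℝ → T3 → ℝ) (u : ℝ → T3 → V3), IsHardSphereEulerSolution σ T ρ u θ →
      ∀ Φ : (N : ℕ) → HardSphereFlow (Torus.geometry (Fin 3)) (hsDiameter σ N) (N + 1),
      TendstoHydroFieldsAt (fun N => localGibbsLaw σ a₀ u₀ θ₀ N (Φ N)) Φ ρ u θ 0 →
      ∀ t ∈ Set.Ico 0 T,
        Tendsto (fun N : ℕ => klDiv ((Φ N).lawAt (localGibbsLaw σ a₀ u₀ θ₀ N (Φ N)) t)
          (localGibbsLaw σ (fun x => ρ t x * Real.exp (hsExcessFreeEnergy (ρ t x * σ ^ 3) +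
            ρ t x * σ ^ 3 * deriv hsExcessFreeEnergy (ρ t x * σ ^ 3))) (u t) (θ t) N (Φ N)) /
          ((N : ℝ≥0∞) + 1)) atTop (𝓝 0))
    (h₇ : HardSphereLDA) (h₈ : LocalGibbsConcentrationDilute) (h₆ : HsEosLowDensity)
    (h₅ : DiluteSelfConsistency) : RelEntropyVanishing := by
  intro a₀ θ₀ u₀ ha hθ hu ha0 hθ0
  obtain ⟨σc, hσc, Hc⟩ := core a₀ θ₀ u₀ ha hθ hu ha0 hθ0
  obtain ⟨η₁, hη₁, HL⟩ := h₇ h₆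
  obtain ⟨η₂, hη₂, HC⟩ := h₈ h₆
  obtain ⟨σd, hσd, Hd⟩ := h₅ (min η₁ η₂) (lt_min hη₁ hη₂) a₀ θ₀ u₀ ha hθ hu ha0 hθ0
  refine ⟨min (1 / 2) (min σc σd), lt_min (by norm_num) (lt_min hσc hσd), fun σ hσ hσlt T ρ θ u hE Φ => ?_⟩
  have hσ2 : σ ≤ 1 / 2 := (hσlt.trans_le (min_le_left _ _)).le
  have hσc' : σ < σc := hσlt.trans_le ((min_le_right _ _).trans (min_le_left _ _))
  have hσd' : σ < σd := hσlt.trans_le ((min_le_right _ _).trans (min_le_right _ _))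
  refine ⟨fun N => isProbabilityMeasure_localGibbsLaw ha hθ hu ha0 hθ0 hσ2 N (Φ N), fun htie t ht => ?_⟩
  have hpack : ∀ x, ρ t x * σ ^ 3 < min η₁ η₂ := Hd σ hσ hσd' T ρ θ u hE Φ htie t ht
  obtain ⟨hprob, hconc⟩ := reference_statics hσ2 (HL σ hσ).2 (HC σ hσ) ha hθ hu ha0 hθ0 hE Φ htie ht hpack
  exact ⟨_, hprob, hconc, Hc σ hσ hσc' T ρ θ u hE Φ htie t ht⟩

/-- **Item `BlockGibbsToRelEntropy` (stmt-AtomisticToContinuum-13464) modulo its relative-entropy core.** If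
the nine antecedents of the item yield Yau's estimate at the Euler-driven reference — for continuous positive
profiles, below some `σ₀`, `KL(lawAt Φ_N λ_N t ‖ localGibbsLaw σ (ρ_t e^{g_σ(ρ_t)}) u_t θ_t)/(N+1) → 0` at
every `t ∈ [0, T)` along every tied classical solution — then the item holds: the other three clauses of
`RelEntropyVanishing` are the statics of `relEntropyVanishing_of_klCore`. [cite: Yau1991, §2] -/
theorem blockGibbsToRelEntropy_of_klCore
    (core : BlockGibbs → CollisionalFluxLocality → EnergyCurrentTails → MeanBlocksInRange →
      EntropicWeakStrongHS → HardSphereLDA → LocalGibbsConcentrationDilute → HsEosLowDensity →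
      DiluteSelfConsistency →
      ∀ (a₀ θ₀ : T3 → ℝ) (u₀ : T3 → V3), Continuous a₀ → Continuous θ₀ → Continuous u₀ →
      (∀ x, 0 < a₀ x) → (∀ x, 0 < θ₀ x) → ∃ σ₀ : ℝ, 0 < σ₀ ∧ ∀ σ : ℝ, 0 < σ → σ < σ₀ →
      ∀ (T : ℝ) (ρ θ : ℝ → T3 → ℝ) (u : ℝ → T3 → V3), IsHardSphereEulerSolution σ T ρ u θ →
      ∀ Φ : (N : ℕ) → HardSphereFlow (Torus.geometry (Fin 3)) (hsDiameter σ N) (N + 1),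
      TendstoHydroFieldsAt (fun N => localGibbsLaw σ a₀ u₀ θ₀ N (Φ N)) Φ ρ u θ 0 →
      ∀ t ∈ Set.Ico 0 T,
        Tendsto (fun N : ℕ => klDiv ((Φ N).lawAt (localGibbsLaw σ a₀ u₀ θ₀ N (Φ N)) t)
          (localGibbsLaw σ (fun x => ρ t x * Real.exp (hsExcessFreeEnergy (ρ t x * σ ^ 3) +
            ρ t x * σ ^ 3 * deriv hsExcessFreeEnergy (ρ t x * σ ^ 3))) (u t) (θ t) N (Φ N)) /
          ((N : ℝ≥0∞) + 1)) atTop (𝓝 0)) :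
    BlockGibbsToRelEntropy :=
  fun h₁ h₂ h₃ h₄ h₉ h₇ h₈ h₆ h₅ =>
    relEntropyVanishing_of_klCore (core h₁ h₂ h₃ h₄ h₉ h₇ h₈ h₆ h₅) h₇ h₈ h₆ h₅

end Summit.AtomisticToContinuum.HydrodynamicLimit.Theorems.JaynesSqueezeClosure

end
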